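import Summits.AtomisticToContinuum.Crystallization.Theorems.FreeSplittingCertificatesApproxFiniteRangeSplittingP2D

/-!
# FreeSplittingCertificates · ApproxFiniteRangeSplitting — part P2F (§9: §F–§G, P2 `blockAveragedRule_holds`)

Part of the split landing of lens-1 g38 v3 `FreeSplittingCertificatesApproxFiniteRangeSplitting.lean` (sha256 6ca014fa…, 1642 l; module docstring of
record in part 1 `…ApproxFiniteRangeSplitting` / the lens file).  Declarations byte-identical; split for the 400-line rule by prover hand 1, gen 12
(decomp-a2c), --supports stmt-AtomisticToContinuum-12562 (the last part `…Holds` closes it).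
-/

namespace Summit.AtomisticToContinuum.Crystallization.Theorems.FreeSplittingCertificatesApproxFiniteRangeSplitting.P2

open scoped BigOperators
open Classical

noncomputable section

variable (V : ℝ → ℝ) (f : ℝ)

variable (L : ℝ)

/-! ## §F The sitewise floor of the averaged rule -/

/-- Floor hypothesis on the certificate family. -/
def WFloor (V : ℝ → ℝ) (f : ℝ) (W : Finset E3 → E3 → E3 → ℝ) : Prop :=
  ∀ (A : Finset E3) (p : E3), p ∈ A → f ≤ ∑ q ∈ A.erase p, W A p q * V (dist p q)

/-- A cube containing `0` has Euclidean diameter `< √3·L`. -/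
theorem norm_le_of_inCube (hL : 0 ≤ L) {c : Fin 3 → ℝ} {u : E3} (hu : InCube L c u)
    (h0 : InCube L c 0) : ‖u‖ ≤ Real.sqrt 3 * L := by
  have hk : ∀ k, ‖u k‖ ^ 2 ≤ L ^ 2 := by
    intro k
    have h1 := hu k
    have h2 := h0 k
    simp only [PiLp.zero_apply, zero_sub] at h2
    rw [Real.norm_eq_abs, sq_abs]
    exact sq_le_sq' (by linarith [h1.2, h2.1]) (by linarith [h1.1, h2.2])
  rw [EuclideanSpace.norm_eq]
  calc Real.sqrt (∑ k, ‖u k‖ ^ 2) ≤ Real.sqrt (∑ _k : Fin 3, L ^ 2) :=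
        Real.sqrt_le_sqrt (Finset.sum_le_sum fun k _ => hk k)
    _ = Real.sqrt 3 * L := by
        rw [Fin.sum_univ_three, show L ^ 2 + L ^ 2 + L ^ 2 = 3 * L ^ 2 by ring,
          Real.sqrt_mul (by norm_num : (0 : ℝ) ≤ 3), Real.sqrt_sq hL]
/-- Auxiliary (lens-1 g38 `ApproxFiniteRangeSplitting` ladder). [folklore] -/

theorem integrable_strip_indicator (v : E3) :
    MeasureTheory.Integrable ((strip L v).indicator fun _ => (1 : ℝ)) := by
  rw [MeasureTheory.integrable_indicator_iff (measurableSet_strip L v)]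
  exact MeasureTheory.integrableOn_const (volume_strip_lt_top L v).ne

section floor

variable {L}
variable {V : ℝ → ℝ} {f : ℝ} {W : Finset E3 → E3 → E3 → ℝ} {N : ℕ} {x : Fin N → E3}

/-- The route's two-endpoint pattern of the bond `(i,j)` at radius `√3·L`, recentred at `x i`. -/
def pat (L : ℝ) (x : Fin N → E3) (i j : Fin N) : Finset E3 :=
  (Finset.univ.filter fun l =>
      dist (x l) (x i) ≤ Real.sqrt 3 * L ∨ dist (x l) (x j) ≤ Real.sqrt 3 * L).image
    fun l => x l - x i

/-- The block of the configuration seen from site `i` in the cube with corner `c`. -/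
def blk (L : ℝ) (x : Fin N → E3) (i : Fin N) (c : Fin 3 → ℝ) : Finset E3 :=
  (Finset.univ.filter fun l => InCube L c (x l - x i)).image fun l => x l - x i
/-- Auxiliary (lens-1 g38 `ApproxFiniteRangeSplitting` ladder). [folklore] -/

theorem sub_injective (hx : Function.Injective x) (i : Fin N) :
    Function.Injective fun l => x l - x i :=
  fun _ _ h => hx (sub_left_injective h)

/-- Inside a cube containing `0`, every bond pattern restricts to the same block. -/
theorem block_eq_blk (hL : 0 ≤ L) (x : Fin N → E3) (i j : Fin N) {c : Fin 3 → ℝ}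
    (h0 : InCube L c 0) :
    block L c (insert 0 (insert (x j - x i) (pat L x i j))) = blk L x i c := by
  ext u
  rw [mem_block, blk, Finset.mem_image]
  constructor
  · rintro ⟨hu, hc⟩
    rcases Finset.mem_insert.1 hu with rfl | hu
    · exact ⟨i, Finset.mem_filter.2 ⟨Finset.mem_univ _, by rwa [sub_self]⟩, sub_self _⟩
    rcases Finset.mem_insert.1 hu with rfl | hu
    · exact ⟨j, Finset.mem_filter.2 ⟨Finset.mem_univ _, hc⟩, rfl⟩
    · rw [pat, Finset.mem_image] at hu
      obtain ⟨l, -, rfl⟩ := hu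
      exact ⟨l, Finset.mem_filter.2 ⟨Finset.mem_univ _, hc⟩, rfl⟩
  · rintro ⟨l, hl, rfl⟩
    have hc := (Finset.mem_filter.1 hl).2
    refine ⟨Finset.mem_insert_of_mem (Finset.mem_insert_of_mem ?_), hc⟩
    rw [pat, Finset.mem_image]
    refine ⟨l, Finset.mem_filter.2 ⟨Finset.mem_univ _, Or.inl ?_⟩, rfl⟩
    rw [dist_eq_norm]
    exact norm_le_of_inCube L hL hc h0

/-- The block certificate's floor, read off at a corner whose cube contains `x i`. -/
theorem floor_at_corner (hF : WFloor V f W) (hx : Function.Injective x) (i : Fin N)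
    {c : Fin 3 → ℝ} (h0 : InCube L c 0) :
    f ≤ ∑ j ∈ (Finset.univ.erase i).filter (fun j => InCube L c (x j - x i)),
      W (blk L x i c) 0 (x j - x i) * V (dist (x i) (x j)) := by
  have hτ := sub_injective hx i
  have h0mem : (0 : E3) ∈ blk L x i c :=
    Finset.mem_image.2 ⟨i, Finset.mem_filter.2 ⟨Finset.mem_univ _, by rwa [sub_self]⟩, sub_self _⟩
  have key := hF (blk L x i c) 0 h0mem
  have hset : (blk L x i c).erase 0 =
      ((Finset.univ.erase i).filter fun j => InCube L c (x j - x i)).image fun l => x l - x i := by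
    rw [Finset.filter_erase, Finset.image_erase hτ]
    simp only [sub_self]
    rfl
  rw [hset, Finset.sum_image fun a _ b _ h => hτ h] at key
  refine key.trans (le_of_eq (Finset.sum_congr rfl fun j _ => ?_))
  rw [dist_eq_norm, zero_sub, norm_neg, ← dist_eq_norm, dist_comm]

/-- Pointwise (in the corner offset) lower bound for the weighted site energy integrand. -/
theorem pointwise_floor (hL : 0 ≤ L) (hF : WFloor V f W) (hx : Function.Injective x) (i : Fin N)
    (c : Fin 3 → ℝ) :
    (corner L 0).indicator (fun _ => f) c -
        (1 / 2) * ∑ j ∈ Finset.univ.erase i,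
          max 0 (-V (dist (x i) (x j))) * (strip L (x j - x i)).indicator (fun _ => (1 : ℝ)) c
      ≤ ∑ j ∈ Finset.univ.erase i,
          gfun L W (x j - x i) (pat L x i j) c * V (dist (x i) (x j)) := by
  by_cases h0 : InCube L c 0
  · have hc0 : c ∈ corner L 0 := (mem_corner L).2 h0
    rw [Set.indicator_of_mem hc0]
    have hg : ∀ j ∈ Finset.univ.erase i,
        gfun L W (x j - x i) (pat L x i j) c * V (dist (x i) (x j)) =
          if InCube L c (x j - x i) then W (blk L x i c) 0 (x j - x i) * V (dist (x i) (x j))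
          else (1 / 2) * V (dist (x i) (x j)) := by
      intro j _
      unfold gfun
      rw [if_pos h0, block_eq_blk hL x i j h0]
      split_ifs <;> rfl
    have hind : ∀ j ∈ Finset.univ.erase i,
        max 0 (-V (dist (x i) (x j))) * (strip L (x j - x i)).indicator (fun _ => (1 : ℝ)) c =
          if InCube L c (x j - x i) then 0 else max 0 (-V (dist (x i) (x j))) := by
      intro j _
      split_ifs with hj
      · rw [Set.indicator_of_notMem, mul_zero]
        intro h
        exact h.2 ((mem_corner L).2 hj)
      · rw [Set.indicator_of_mem, mul_one]
        exact ⟨hc0, fun h => hj ((mem_corner L).1 h)⟩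
    rw [Finset.sum_congr rfl hg, Finset.sum_congr rfl hind, Finset.sum_ite, Finset.sum_ite,
      Finset.sum_const_zero, zero_add]
    have hfl := floor_at_corner hF hx i h0
    have hneg : ∀ j ∈ (Finset.univ.erase i).filter (fun j => ¬ InCube L c (x j - x i)),
        -((1 / 2) * max 0 (-V (dist (x i) (x j)))) ≤ (1 / 2) * V (dist (x i) (x j)) := by
      intro j _
      have := le_max_right 0 (-V (dist (x i) (x j)))
      linarith
    have hsum := Finset.sum_le_sum hneg
    rw [Finset.sum_neg_distrib, ← Finset.mul_sum] at hsum
    linarith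
  · have hc0 : c ∉ corner L 0 := fun h => h0 ((mem_corner L).1 h)
    rw [Set.indicator_of_notMem hc0]
    have hg : ∀ j ∈ Finset.univ.erase i,
        gfun L W (x j - x i) (pat L x i j) c * V (dist (x i) (x j)) = 0 := by
      intro j _
      unfold gfun
      rw [if_neg h0, zero_mul]
    have hind : ∀ j ∈ Finset.univ.erase i,
        max 0 (-V (dist (x i) (x j))) * (strip L (x j - x i)).indicator (fun _ => (1 : ℝ)) c = 0 := by
      intro j _
      rw [Set.indicator_of_notMem (fun h => hc0 h.1), mul_zero]
    rw [Finset.sum_congr rfl hg, Finset.sum_congr rfl hind]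
    simp

/-- **The floor.** `f − ½ Σ_j V⁻(r_ij)·min(1, √3 r_ij/L) ≤ Σ_j Φ(v_j, T_j)·V(r_ij)`. -/
theorem floor_sum (hL : 0 < L) (hW : WBox W) (hF : WFloor V f W) (hx : Function.Injective x)
    (i : Fin N) :
    f - (1 / 2) * ∑ j ∈ Finset.univ.erase i,
        max 0 (-V (dist (x i) (x j))) * min 1 (Real.sqrt 3 * dist (x i) (x j) / L)
      ≤ ∑ j ∈ Finset.univ.erase i, Phi L W (x j - x i) (pat L x i j) * V (dist (x i) (x j)) := by
  have hL3 : 0 < L ^ 3 := pow_pos hL 3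
  set s := Finset.univ.erase i with hs
  have hm0 : ∀ j, 0 ≤ max 0 (-V (dist (x i) (x j))) := fun j => le_max_left _ _
  -- the right-hand side as one integral
  have hR : ∑ j ∈ s, Phi L W (x j - x i) (pat L x i j) * V (dist (x i) (x j)) =
      (L ^ 3)⁻¹ * ∫ c, ∑ j ∈ s, gfun L W (x j - x i) (pat L x i j) c * V (dist (x i) (x j)) := by
    rw [MeasureTheory.integral_finsetSum _ fun j _ => (integrable_gfun L hW _ _).mul_const _,
      Finset.mul_sum]
    refine Finset.sum_congr rfl fun j _ => ?_
    rw [MeasureTheory.integral_mul_const, Phi, mul_assoc]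
  -- the two pieces of the lower bound
  have hI1 : ∫ c, (corner L 0).indicator (fun _ => f) c = L ^ 3 * f := by
    rw [MeasureTheory.integral_indicator_const _ (measurableSet_corner L 0), smul_eq_mul,
      MeasureTheory.measureReal_def, volume_corner_toReal L hL.le]
  have hI2 : ∫ c, (1 / 2 : ℝ) * ∑ j ∈ s, max 0 (-V (dist (x i) (x j))) *
        (strip L (x j - x i)).indicator (fun _ => (1 : ℝ)) c =
      (1 / 2) * ∑ j ∈ s, max 0 (-V (dist (x i) (x j))) *
        (MeasureTheory.volume (strip L (x j - x i))).toReal := by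
    rw [MeasureTheory.integral_const_mul, MeasureTheory.integral_finsetSum _ fun j _ =>
      (integrable_strip_indicator L _).const_mul _]
    congr 1
    refine Finset.sum_congr rfl fun j _ => ?_
    rw [MeasureTheory.integral_const_mul,
      MeasureTheory.integral_indicator_const _ (measurableSet_strip L _), smul_eq_mul, mul_one,
      MeasureTheory.measureReal_def]
  have hintA : MeasureTheory.Integrable (fun c => (corner L 0).indicator (fun _ => f) c) := by
    rw [show (fun c => (corner L 0).indicator (fun _ => f) c) = (corner L 0).indicator (fun _ => f)
      from rfl, MeasureTheory.integrable_indicator_iff (measurableSet_corner L 0)]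
    exact MeasureTheory.integrableOn_const (volume_corner_lt_top L 0).ne
  have hintB : MeasureTheory.Integrable (fun c => (1 / 2 : ℝ) * ∑ j ∈ s,
      max 0 (-V (dist (x i) (x j))) * (strip L (x j - x i)).indicator (fun _ => (1 : ℝ)) c) :=
    (MeasureTheory.integrable_finsetSum _ fun j _ =>
      (integrable_strip_indicator L _).const_mul _).const_mul _
  have hint_rhs : MeasureTheory.Integrable (fun c => ∑ j ∈ s,
      gfun L W (x j - x i) (pat L x i j) c * V (dist (x i) (x j))) :=
    MeasureTheory.integrable_finsetSum _ fun j _ => (integrable_gfun L hW _ _).mul_const _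
  have hintAB : MeasureTheory.Integrable (fun c => (corner L 0).indicator (fun _ => f) c -
      (1 / 2 : ℝ) * ∑ j ∈ s, max 0 (-V (dist (x i) (x j))) *
        (strip L (x j - x i)).indicator (fun _ => (1 : ℝ)) c) := hintA.sub hintB
  have hmono := MeasureTheory.integral_mono hintAB hint_rhs
    (fun c => pointwise_floor hL.le hF hx i c)
  rw [MeasureTheory.integral_sub hintA hintB, hI1, hI2] at hmono
  -- strip volumes
  have hvol : ∑ j ∈ s, max 0 (-V (dist (x i) (x j))) *
        (MeasureTheory.volume (strip L (x j - x i))).toReal ≤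
      L ^ 3 * ∑ j ∈ s, max 0 (-V (dist (x i) (x j))) * min 1 (Real.sqrt 3 * dist (x i) (x j) / L) := by
    rw [Finset.mul_sum]
    refine Finset.sum_le_sum fun j _ => ?_
    rw [mul_left_comm]
    refine mul_le_mul_of_nonneg_left ?_ (hm0 j)
    rw [dist_comm, dist_eq_norm]
    exact volume_strip_le L hL (x j - x i)
  rw [hR, le_inv_mul_iff₀ hL3]
  linarith

end floor

/-! ## §G Assembly of P2 (the parent namespace's `BlockAveragedRule`, §5) -/

/-- **P2 holds.** The Haar-averaged block rule built from the block certificates. -/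
theorem blockAveragedRule_holds : BlockAveragedRule := by
  intro V f L hL h
  have hW : WBox (cert V f h) := fun A p q hp hq => cert_mem_Icc V f h hp hq
  have hS : WShift (cert V f h) := fun A hA u p q => cert_shift V f h hA u p q
  have hC : WSymm (cert V f h) := fun A p q hp hq hpq => cert_add_symm V f h hp hq hpq
  have hF : WFloor V f (cert V f h) := fun A p hp => cert_floor V f h hp
  refine ⟨Phi L (cert V f h), ⟨fun v T => Phi_box L hW hL v T,
    fun v T hv => Phi_complementary L hW hS hC hL hv T⟩, ?_⟩
  intro N x hx i
  exact floor_sum hL hW hF hx i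

end

end Summit.AtomisticToContinuum.Crystallization.Theorems.FreeSplittingCertificatesApproxFiniteRangeSplitting.P2
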